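import Mathlib
import HarnessLib
import Literature.FieldTheory.AlgClosed.PadicAlgClEquivComplex
import Summits.Langlands.Langlands.Theses.EvenIcosahedralCMCorner
import Literature.NumberTheory.GaloisRepresentations.ArtinRestriction
import Literature.NumberTheory.Automorphic.TunnellOctahedralGlobal
import Literature.NumberTheory.Automorphic.RankinSelbergLocalGammaCounterexample
import Summits.Langlands.Langlands.Theorems.EvenIcosahedralCMCornerUntwistAutomorphy
import Literature.NumberTheory.GaloisRepresentations.ArtinCharacterReciprocityProofs
import Literature.NumberTheory.GaloisRepresentations.HeckeLFunctionAnalyticProofs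
import Literature.NumberTheory.GaloisRepresentations.HeckeCharacterProofs
import Literature.NumberTheory.Automorphic.AutomorphicTwistBJ
import Literature.NumberTheory.Automorphic.AutomorphicTwistSatake
import Literature.NumberTheory.Automorphic.BaseChangeStrongUnramifiedRankOne

/-!
# SplitPrimeDescentLadder — a lens-1 («grading / quantitative ladder») node on route `EvenIcosahedralCMCorner`

(decomp-langlands cell, seat lens-1, generation 33.  NODE: a kernel-checked re-gluing of the OPEN route
`EvenIcosahedralCMCorner` (items `stmt-Langlands-14074…14081`, deciding theorem `EvenIcosahedralCMCorner.closes`)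
in which the route's one IDEA-NEEDED crux, the soluble descent with Galois matching `SolubleDescentMatching`
(`stmt-Langlands-14077`, binder `hH`), is replaced by a statement that is a THEOREM of cyclic base change, at the
price of bookkeeping-type strengthenings of the door, the engine and the classicality wall; 0 sorry.)

## The ladder (index = the family of auxiliary fields over which automorphy is supplied)

For an even icosahedral `σ : Γ_ℚ → GL₂(ℂ)`:

* rung `1` — ONE soluble Galois field `M'` and a cuspidal `π'` on `GL₂(𝔸_{M'})` matching `σ|_{M'}` almost
  everywhere: `SolubleDescentMatching` as filed.  OPEN, and for a structural reason: descending `π'` down a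
  cyclic layer `M'/M₁` of prime degree `ℓ` produces `π₁` only up to the `ℓ` twists by the characters of
  `Gal(M'/M₁)`; at a place `v` of `M₁` INERT in `M'` these candidates have DIFFERENT Satake parameters
  (`ζ^i · t_v`) and only one matches `σ|_{M₁}(Frob_v)` — choosing it is local–global compatibility for
  `π₁`, i.e. the Galois representation of a Maaß-type form, absent in print (Langlands–Tunnell had odd
  weight one; Booker 2003 / Calegari 2023 §12: no engine for a single even `A₅`).
* rung `k < ω` — finitely many such fields: STILL SHORT.  Every field is CM, so at the (positive density of)
  primes `p` whose Frobenius is complex conjugation on each of the finitely many imaginary quadratic subfields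
  every residue degree above `p` is even and only `t_p²` is pinned — a sign no finite CM family resolves.
* rung `ω` — `CofinalCyclicDescent`: for ALL BUT FINITELY MANY rational primes `p` a Galois field `M'_p`
  with `Gal(M'_p/ℚ)` CYCLIC of SQUAREFREE order whose odd prime divisors lie in the private window
  `[2^p, 2^{p+1})`, in which `p` SPLITS COMPLETELY, and a cuspidal `π'_p` on `GL₂(𝔸_{M'_p})` matching
  `σ|_{M'_p}` almost everywhere AND at the places above `p`.  This is a THEOREM of the trace formula plus
  Chebotarev (no Galois representations downstairs), along the following lines.
  (1) DESCENT.  Descend `π'_p` down the cyclic tower of `M'_p` one prime-degree step at a time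
  (Arthur–Clozel III.4.2/III.6, tree `ArthurClozel1989_cuspidal_descent`, RepData form
  `CuspidalDescentCyclicRepData`, `TunnellOctahedralGlobal.cuspidal_descent_cyclic`).  Galois-stability at an
  intermediate level is automatic because the step orders are DISTINCT primes: the next generator `s` acts on
  the fibre `{π₁ ⊗ ε^i}` (a `ℤ/ℓ'`-torsor, III.3.1 / `ArthurClozelFibresRepData`) through a homomorphism
  `⟨s⟩ → ℤ/ℓ'`, trivial as `ℓ' ∤ ord s`; cuspidality and "no self-twist" at every level follow from
  `σ` being projectively `A₅` (a self-twist forces Satake multisets `{α, -α}` on a set of places of positive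
  density, hence `tr σ = 0` on a Chebotarev set containing Frobenii of projective order `3` — impossible;
  here `K_σ ∩ M'_p = ℚ` since `A₅` has no cyclic quotient).  Output: a cuspidal `π_p` on `GL₂/ℚ` with
  `t_{π_p}(q) = tr σ(Frob_q)` at a.e. `q` split completely in `M'_p` AND at `q = p` (strong base change at a
  split unramified place is the identity, `ArthurClozel1989_strongLifting_unramified`; every fibre character
  of `Gal(M'_p/ℚ)` is trivial at such `q`).
  (2) COMPARISON.  For `p ≠ p'` base-change `π'_p`, `π'_{p'}` up to the compositum `L = M'_p M'_{p'}` (cyclic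
  squarefree steps; both lifts match `σ|_L` a.e., so they agree a.e. and strong multiplicity one over `L`
  applies, `JacquetShalika`/`StrongMultiplicityOneRepData`), then descend the equality down a prime-step tower
  of the ABELIAN extension `L/ℚ` through `M'_p` (fibres are twists; step characters extend because `Gal(L/ℚ)`
  is abelian): `π_{p'} ≃ π_p ⊗ u v` a.e., `u` a character of `Gal(M'_p/ℚ)`, `v` of `Gal(M'_{p'}/ℚ)`.
  (3) RIGIDITY ACROSS THE FAMILY — why the window.  Fix `p₁`; write `π_{p'} ≃ π_{p₁} ⊗ e_{p'} f_{p'}`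
  (`e_{p'} ∈ X_{p₁} := Gal(M'_{p₁}/ℚ)^∨`, `f_{p'} ∈ X_{p'}`); since `f_{p'}(Frob_{p'}) = 1`,
  `π_{p₁} ⊗ e_{p'}` matches `σ` AT `p'`.  Comparing `p'` with `p''` and using "no self-twist of `π_{p₁}`":
  `e_{p''}/e_{p'}` is a character of `E := M'_{p₁} ∩ M'_{p'}M'_{p''}`.  The private windows make the odd parts
  of the three degrees pairwise coprime, so `[E:ℚ] ∣ 2` and `E ≠ ℚ` only if the imaginary quadratic subfield
  `k_{p₁}` of `M'_{p₁}` equals `k_{p'}` or `k_{p''}`.  Choose the reference `p''` with `k_{p''} ≠ k_{p₁}`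
  (possible: the family is cofinite and half of all primes are inert in `k_{p₁}`); then for every `p'` either
  `e_{p'} = e_{p''}` or `k_{p'} = k_{p₁}` and `e_{p'} = e_{p''} η_{k_{p₁}}` with `η_{k_{p₁}}(p') = 1` (`p'` splits in
  `M'_{p'} ⊇ k_{p'} = k_{p₁}`).  Either way `π := π_{p₁} ⊗ e_{p''}` matches `σ` at every `p'` of the family:
  `EvenIcosahedralStrongArtin` for `σ`.  WITHOUT the window a "diagonal" cyclic subfield `D ⊂ M'_{p'}M'_{p''}`,
  `D ⊂ M'_{p₁}`, `D ⊄ M'_{p'}, M'_{p''}` leaves an `ℓ`-th-root-of-unity ambiguity no trace-formula statement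
  removes; the window (disjoint for distinct `p`, non-empty by Bertrand) is the cheapest `p`-LOCAL device forcing
  pairwise coprimality, so every statement stays inside one `∀ᶠ p` and the glue is `Filter.Eventually.mono`.
  The twist ambiguity that kills rung `1` is INVISIBLE at a completely split prime; letting that prime range
  over a cofinite set, with private degree windows, is the quantitative parameter of this lens.

## Pieces (tags relative to the route's items; all `Prop`s over existing declarations)

* `CofinalSplitDoor` (D∞) — STRONGER-ASK than `CMOrdinaryDoor` (14076; cert `cmOrdinaryDoor_of_cofinalSplitDoor`):
  the door's data for a.e. `p` over a CM field `M_p` that is CYCLIC over `ℚ` of SQUAREFREE degree with odd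
  prime divisors in `[2^p, 2^{p+1})`, `p` split completely, imaginary quadratic subfield `ℚ(√-d)`, `d ≡ 2 (3)`
  (so `3` splits in it — the engine's ACC⁺ condition, which a cyclic `M' ⊇ M` cannot add later), and `χ`, `τ₃`
  unramified above `p`.  Leaf: IDEA-NEEDED (as D: residual ordinary automorphy of `τ̄₃` over a prescribed
  family of CM cyclic fields).
* `ShapePreservingEngine` (E∞) — VARIANT-ASK of `ProAutomorphyAtKleinPrime` (14074; incomparable: stronger
  conclusion under stronger hypotheses): the engine's soluble CM extension `M' ⊇ M` keeps the shape (cyclic,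
  squarefree, window, `p` split) and its tame level is unramified above `p`.  Allowable: auxiliary layers cyclic
  of fresh prime degree `ℓ ∈ [2^p, 2^{p+1})` inside `ℚ(ζ_q)`, `q ≡ 1 (ℓ)`, with `p` and the relevant primes
  `ℓ`-th powers mod `q` (Dirichlet); coprime cyclic factors compose to a cyclic group.  Leaf: INSTRUMENTABLE
  (same Λ-adic ordinary patching at `p = 3` as E).
* `ClassicalityOffBadPlaces` (F∞) — STRONGER-ASK than `ArtinPointClassicalityCM` (14075; cert
  `artinPointClassicalityCM_of_classicalityOffBadPlaces`): classicality of the Artin point WITH local–global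
  compatibility at every place outside the tame level's bad set (what `TameLevel.IsAssociated` records there).
  Leaf: BARRIER-class (non-regular weight), as F.
* `UntwistAutomorphyAt` (G∞) — pointwise form of `UntwistAutomorphy` (14079, closed): PROVED HERE
  (`untwistAutomorphyAt_proof`, via `exists_level_not_dvd_of_isUnramifiedAt` = a level of `ω ∘ det` prime to
  an unramified place; cert `untwistAutomorphy_of_untwistAutomorphyAt`).  Leaf: THEOREM.
* `CofinalCyclicDescent` (H∞) — WEAKER than `SolubleDescentMatching` (cert
  `cofinalCyclicDescent_of_solubleDescentMatching`) and implied by strong Artin for `σ`; leaf ATTACKABLE by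
  (1)–(3) above over the tree's Arthur–Clozel / Tunnell RepData vocabulary (named AC facts as hypotheses where
  unproved: `ArthurClozel1989_strongLifting_unramified`, `…_cuspidal_descent`, `…_fibres_of_baseChange`).
* `NonDistinguishedComplement` (14078, residual) and `SectorJunction` (13565) BY NAME.

Deciding theorems (census naming rule: never a bare `closes`): `langlands_of_pieces : D∞ → E∞ → F∞ → G∞ → H∞ → NonDistinguishedComplement → SectorJunction →
Langlands` and, with the decided leaf discharged, `closes_target : D∞ → E∞ → F∞ → H∞ →
NonDistinguishedComplement → SectorJunction → Langlands` (0 sorry; the `3`-distinguished / complementary case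
split as in `EvenIcosahedralCMCorner.closes`, `ℚ̄₃ ≃ ℂ` from `PadicAlgCl.nonempty_ringEquiv_complex`; the new glue is `Filter.Eventually.mono`
along the door's cofinite filter, `exists_under_eq` + `Ideal.under_under` + `isUnramifiedAt_restrictField` to
move "unramified above `p`" from `M` to `M'`, and `w ∉ 𝒰.bad` to carry the matching above `p`).

Why novel (vs the cell's tree and the sub's routes): no existing route or node descends through a COFINAL
FAMILY of cyclic fields indexed by a completely split prime; `RealQuadraticDoorDescent` (EvenArtinGL4Door)
uses ONE real quadratic layer and Rankin–Selberg sign resolution on a density-one set, lens-4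
`CyclicLayerPeeling` grades by the LENGTH of one soluble tower, `LanglandsTetrahedralOfCyclicDescent` is the
single cubic layer with Galois representations downstairs (odd case), ACC soluble descent selects the twist by
`r_ι` (regular algebraic weight only).  Refs: Arthur–Clozel, Ann. Math. Studies 120 (1989) Ch. 3 Thm. 3.1,
Thm. 4.2, Lemmas 6.3/6.6 [ArthurClozelAMS120]; Langlands, *Base change for GL(2)* (1980) §2; Jacquet–Shalika (1981)
Thm. 4.4; Lapid–Rogawski (1998); Booker (2003), Calegari (2023 §12); Bertrand (`Nat.exists_prime_lt_and_le_two_mul`).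
-/

set_option linter.dupNamespace false -- project-wide option; `Summit.Langlands.Langlands` is the mandated namespace
noncomputable section
namespace Summit.Langlands.Langlands.Theorems.SplitPrimeDescentLadder
open Summit.Langlands.Langlands.Theses.EvenIcosahedralCMCorner

/-- **D∞ `CofinalSplitDoor`** — STRONGER-ASK than `EvenIcosahedralCMCorner.CMOrdinaryDoor`
(`stmt-Langlands-14076`); leaf IDEA-NEEDED (door).  For an irreducible even icosahedral `σ` that is
unramified and `3`-distinguished at `3`: for ALL BUT FINITELY MANY rational primes `p` there is a Galois CM
field `M` with `Gal(M/ℚ)` cyclic of squarefree order whose odd prime divisors lie in `[2^p, 2^{p+1})`, `p` split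
completely in `M`, imaginary quadratic subfield `ℚ(√-d)` with `d ≡ 2 (mod 3)`, `ζ₃ ∉ M`, a character
`χ` and `τ = χ ⊗ σ|_M` with a `3`-adic model `τ₃` of finite image, `χ` and `τ₃` unramified above `p`, and
the residual-ordinary-automorphy data of the route's door verbatim.  Why it might fail: the door's field
may be forced to ramify at / not split `p` for a density of `p` (Ellenberg-type constructions fix the
field by a Diophantine condition).  [EllenbergSerreF9-2005; ShepherdBarronTaylor1997; AllenKhareThorne2021] -/
def CofinalSplitDoor : Prop :=
  ∀ (ι : PadicAlgCl 3 ≃+* ℂ) (σ : Literature.NumberTheory.GaloisRepresentations.FramedGaloisRep ℚ ℂ 2), σ.toGaloisRep.IsIrreducible → Nonempty ((Matrix.ProjGenLinGroup.mk.comp σ.toMonoidHom).range ≃* alternatingGroup (Fin 5)) → (∀ (φ : ℚ →+* ℝ) (c : Field.absoluteGaloisGroup ℚ), Literature.NumberTheory.GaloisRepresentations.IsComplexConjugation φ c → Matrix.GeneralLinearGroup.det (σ c) = 1) → (∀ v : IsDedekindDomain.HeightOneSpectrum (NumberField.RingOfIntegers ℚ), (3 : NumberField.RingOfIntegers ℚ)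 ∈ v.asIdeal → σ.IsUnramifiedAt v ∧ ∃ t d : ℂ, σ.HasFrobCharpolyAt v (Polynomial.X ^ 2 - Polynomial.C t * Polynomial.X + Polynomial.C d) ∧ t ^ 2 ≠ d ∧ t ^ 2 ≠ 4 * d) → ∀ᶠ p : IsDedekindDomain.HeightOneSpectrum (NumberField.RingOfIntegers ℚ) in Filter.cofinite, ∃ (M : Type) (_ : Field M) (_ : NumberField M), NumberField.IsCMField M ∧ IsGalois ℚ M ∧ IsCyclic (M ≃ₐ[ℚ] M) ∧ Squarefree (Module.finrank ℚ M) ∧ (∀ ℓ : ℕ, ℓ.Prime → ℓ ∣ Module.finrank ℚ M → ℓ = 2 ∨ (2 ^ Ideal.absNorm p.asIdeal ≤ ℓ ∧ ℓ < 2 ^ (Ideal.absNorm p.asIdeal + 1))) ∧ (∀ w : IsDedekindDomain.HeightOneSpectrum (NumberField.RingOfIntegers M), w.asIdeal.under (NumberField.RingOfIntegers ℚ) = p.asIdeal → w.asIdeal.inertiaDeg (NumberField.RingOfIntegers ℚ) = 1 ∧ w.asIdeal.ramificationIdx (NumberField.RingOfIntegers ℚ) = 1) ∧ (∃ (d : ℕ)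 (z : M), d % 3 = 2 ∧ z ^ 2 + (d : M) = 0) ∧ (∀ z : M, z ^ 2 + z + 1 ≠ 0) ∧ ∃ (χ : Literature.NumberTheory.GaloisRepresentations.FramedGaloisRep M ℂ 1) (τ : Literature.NumberTheory.GaloisRepresentations.FramedGaloisRep M ℂ 2) (τ₃ : Literature.NumberTheory.GaloisRepresentations.FramedGaloisRep M (PadicAlgCl 3) 2), (∀ g : Field.absoluteGaloisGroup M, ((τ g : Matrix.GeneralLinearGroup (Fin 2) ℂ) : Matrix (Fin 2) (Fin 2) ℂ) = ((Matrix.GeneralLinearGroup.det (χ g) : ℂˣ) : ℂ) • ((Literature.NumberTheory.GaloisRepresentations.FramedGaloisRep.restrictField M σ g : Matrix.GeneralLinearGroup (Fin 2) ℂ) : Matrix (Fin 2) (Fin 2) ℂ)) ∧ (∀ g : Field.absoluteGaloisGroup M, ((τ₃ g : Matrix.GeneralLinearGroup (Fin 2) (PadicAlgCl 3)) : Matrix (Fin 2) (Fin 2) (PadicAlgCl 3)).map ι = ((τ g : Matrix.GeneralLinearGroup (Fin 2) ℂ) : Matrix (Fin 2) (Fin 2) ℂ)) ∧ Finite τ₃.toMonoidHom.range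 ∧ (∀ w : IsDedekindDomain.HeightOneSpectrum (NumberField.RingOfIntegers M), w.asIdeal.under (NumberField.RingOfIntegers ℚ) = p.asIdeal → χ.IsUnramifiedAt w ∧ τ₃.IsUnramifiedAt w) ∧ (Nonempty ((Matrix.ProjGenLinGroup.mk.comp τ₃.toMonoidHom).range ≃* alternatingGroup (Fin 5)) ∧ (∀ w : IsDedekindDomain.HeightOneSpectrum (NumberField.RingOfIntegers M), (3 : NumberField.RingOfIntegers M) ∈ w.asIdeal → τ₃.IsUnramifiedAt w ∧ ∃ t d : PadicAlgCl 3, τ₃.HasFrobCharpolyAt w (Polynomial.X ^ 2 - Polynomial.C t * Polynomial.X + Polynomial.C d) ∧ ‖t ^ 2 - 4 * d‖ = 1) ∧ ∃ (hM : Literature.NumberTheory.Automorphic.isCompact_glFiniteIntegralLevel 2 M) (π : Literature.NumberTheory.Automorphic.CuspidalAutomorphicRepData 2 M hM), π.1.HasWeightZero ∧ (∀ w : IsDedekindDomain.HeightOneSpectrum (NumberField.RingOfIntegers M), (3 : NumberField.RingOfIntegers M) ∈ w.asIdeal → ∃ α : Multiset ℂ, π.1.HasSatakeParamAt w α ∧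 ∃ a ∈ α, ‖ι.symm (Real.sqrt w.residueCard * a)‖ = 1) ∧ (∀ᶠ w : IsDedekindDomain.HeightOneSpectrum (NumberField.RingOfIntegers M) in Filter.cofinite, ∃ (α : Multiset ℂ) (t d : PadicAlgCl 3), π.1.HasSatakeParamAt w α ∧ τ₃.IsUnramifiedAt w ∧ τ₃.HasFrobCharpolyAt w (Polynomial.X ^ 2 - Polynomial.C t * Polynomial.X + Polynomial.C d) ∧ ‖t - ι.symm (Real.sqrt w.residueCard * α.sum)‖ < 1))

/-- **E∞ `ShapePreservingEngine`** — VARIANT-ASK of `EvenIcosahedralCMCorner.ProAutomorphyAtKleinPrime`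
(`stmt-Langlands-14074`); leaf INSTRUMENTABLE (engine).  The engine's soluble CM extension `M' ⊇ M` is asked
to stay CYCLIC of SQUAREFREE order over `ℚ` with odd prime divisors in the window `[2^p, 2^{p+1})`, the given
prime `p` still split completely and the tame level `𝒰` of the pro-automorphy unramified above `p`, granted that
`M` has this shape (and an imaginary quadratic subfield in which `3` splits) and `τ₃` is unramified above `p`.  Why it might fail: an allowable-base-change step of the patching argument might
need a layer of degree dividing `[M:ℚ]` or ramified at `p`.  [KhareThorne2017 Thm 6.30; ACCGHLNSTT2023 §6] -/
def ShapePreservingEngine : Prop :=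
  ∀ (ι : PadicAlgCl 3 ≃+* ℂ) (M : Type) [Field M] [NumberField M] (p : IsDedekindDomain.HeightOneSpectrum (NumberField.RingOfIntegers ℚ)), NumberField.IsCMField M → IsGalois ℚ M → IsCyclic (M ≃ₐ[ℚ] M) → Squarefree (Module.finrank ℚ M) → (∀ ℓ : ℕ, ℓ.Prime → ℓ ∣ Module.finrank ℚ M → ℓ = 2 ∨ (2 ^ Ideal.absNorm p.asIdeal ≤ ℓ ∧ ℓ < 2 ^ (Ideal.absNorm p.asIdeal + 1))) → (∀ w : IsDedekindDomain.HeightOneSpectrum (NumberField.RingOfIntegers M), w.asIdeal.under (NumberField.RingOfIntegers ℚ) = p.asIdeal → w.asIdeal.inertiaDeg (NumberField.RingOfIntegers ℚ) = 1 ∧ w.asIdeal.ramificationIdx (NumberField.RingOfIntegers ℚ) = 1) → (∃ (d : ℕ) (z : M), d % 3 = 2 ∧ z ^ 2 + (d : M) = 0) → (∀ z : M, z ^ 2 + z + 1 ≠ 0) → ∀ τ₃ : Literature.NumberTheory.GaloisRepresentations.FramedGaloisRep M (PadicAlgCl 3) 2, Finite τ₃.toMonoidHom.range → (∀ w : IsDedekindDomain.HeightOneSpectrum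 (NumberField.RingOfIntegers M), w.asIdeal.under (NumberField.RingOfIntegers ℚ) = p.asIdeal → τ₃.IsUnramifiedAt w) → (Nonempty ((Matrix.ProjGenLinGroup.mk.comp τ₃.toMonoidHom).range ≃* alternatingGroup (Fin 5)) ∧ (∀ w : IsDedekindDomain.HeightOneSpectrum (NumberField.RingOfIntegers M), (3 : NumberField.RingOfIntegers M) ∈ w.asIdeal → τ₃.IsUnramifiedAt w ∧ ∃ t d : PadicAlgCl 3, τ₃.HasFrobCharpolyAt w (Polynomial.X ^ 2 - Polynomial.C t * Polynomial.X + Polynomial.C d) ∧ ‖t ^ 2 - 4 * d‖ = 1) ∧ ∃ (hM : Literature.NumberTheory.Automorphic.isCompact_glFiniteIntegralLevel 2 M) (π : Literature.NumberTheory.Automorphic.CuspidalAutomorphicRepData 2 M hM), π.1.HasWeightZero ∧ (∀ w : IsDedekindDomain.HeightOneSpectrum (NumberField.RingOfIntegers M), (3 : NumberField.RingOfIntegers M) ∈ w.asIdeal → ∃ α : Multiset ℂ, π.1.HasSatakeParamAt w α ∧ ∃ a ∈ α, ‖ι.symm (Real.sqrt w.residueCard * a)‖ = 1) ∧ (∀ᶠ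 w : IsDedekindDomain.HeightOneSpectrum (NumberField.RingOfIntegers M) in Filter.cofinite, ∃ (α : Multiset ℂ) (t d : PadicAlgCl 3), π.1.HasSatakeParamAt w α ∧ τ₃.IsUnramifiedAt w ∧ τ₃.HasFrobCharpolyAt w (Polynomial.X ^ 2 - Polynomial.C t * Polynomial.X + Polynomial.C d) ∧ ‖t - ι.symm (Real.sqrt w.residueCard * α.sum)‖ < 1)) → ∃ (M' : Type) (_ : Field M') (_ : NumberField M') (_ : Algebra M M'), NumberField.IsCMField M' ∧ IsGalois ℚ M' ∧ IsCyclic (M' ≃ₐ[ℚ] M') ∧ Squarefree (Module.finrank ℚ M') ∧ (∀ ℓ : ℕ, ℓ.Prime → ℓ ∣ Module.finrank ℚ M' → ℓ = 2 ∨ (2 ^ Ideal.absNorm p.asIdeal ≤ ℓ ∧ ℓ < 2 ^ (Ideal.absNorm p.asIdeal + 1))) ∧ (∀ w : IsDedekindDomain.HeightOneSpectrum (NumberField.RingOfIntegers M'), w.asIdeal.under (NumberField.RingOfIntegers ℚ) = p.asIdeal → w.asIdeal.inertiaDeg (NumberField.RingOfIntegers ℚ) = 1 ∧ w.asIdeal.ramificationIdx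 (NumberField.RingOfIntegers ℚ) = 1) ∧ Finite (Literature.NumberTheory.GaloisRepresentations.FramedGaloisRep.restrictField M' τ₃).toMonoidHom.range ∧ Nonempty ((Matrix.ProjGenLinGroup.mk.comp (Literature.NumberTheory.GaloisRepresentations.FramedGaloisRep.restrictField M' τ₃).toMonoidHom).range ≃* alternatingGroup (Fin 5)) ∧ ∃ 𝒰 : Literature.NumberTheory.Automorphic.BigHeckeGLn.TameLevel 2 M' 3, (∀ w : IsDedekindDomain.HeightOneSpectrum (NumberField.RingOfIntegers M'), w.asIdeal.under (NumberField.RingOfIntegers ℚ) = p.asIdeal → w ∉ 𝒰.bad) ∧ 𝒰.IsPadicallyAutomorphic (Literature.NumberTheory.GaloisRepresentations.FramedGaloisRep.restrictField M' τ₃)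

/-- **F∞ `ClassicalityOffBadPlaces`** — STRONGER-ASK than `EvenIcosahedralCMCorner.ArtinPointClassicalityCM`
(`stmt-Langlands-14075`); leaf BARRIER-class (non-regular weight classicality), as F.  A finite-image,
projectively icosahedral Artin point `τ₃` (complex avatar `τ`) of the completed cohomology of `GL₂` over a
CM field at tame level `𝒰` is CLASSICAL with local–global compatibility at EVERY place outside `𝒰.bad`:
a cuspidal `π` whose Satake parameters give `charpoly τ(Frob_w)` for a.e. `w` and for all `w ∉ 𝒰.bad`.
Why it might fail: as F (no classicality theorem in non-cohomological weight over CM fields); the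
pointwise clause is what `IsAssociated` already records at `w ∉ 𝒰.bad`.  [HansenUniversalEigenvarieties2017
Conj. 1.2.3; GeeNewton2020 §3.3] -/
def ClassicalityOffBadPlaces : Prop :=
  ∀ (ι : PadicAlgCl 3 ≃+* ℂ) (M : Type) [Field M] [NumberField M], NumberField.IsCMField M → ∀ (τ : Literature.NumberTheory.GaloisRepresentations.FramedGaloisRep M ℂ 2) (τ₃ : Literature.NumberTheory.GaloisRepresentations.FramedGaloisRep M (PadicAlgCl 3) 2), (∀ g : Field.absoluteGaloisGroup M, ((τ₃ g : Matrix.GeneralLinearGroup (Fin 2) (PadicAlgCl 3)) : Matrix (Fin 2) (Fin 2) (PadicAlgCl 3)).map ι = ((τ g : Matrix.GeneralLinearGroup (Fin 2) ℂ) : Matrix (Fin 2) (Fin 2) ℂ)) → Finite τ₃.toMonoidHom.range → Nonempty ((Matrix.ProjGenLinGroup.mk.comp τ₃.toMonoidHom).range ≃* alternatingGroup (Fin 5)) → ∀ 𝒰 : Literature.NumberTheory.Automorphic.BigHeckeGLn.TameLevel 2 M 3, 𝒰.IsPadicallyAutomorphic τ₃ → ∃ (hM : Literature.NumberTheory.Automorphic.isCompact_glFiniteIntegralLevel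 2 M) (π : Literature.NumberTheory.Automorphic.CuspidalAutomorphicRepData 2 M hM), (∀ᶠ w : IsDedekindDomain.HeightOneSpectrum (NumberField.RingOfIntegers M) in Filter.cofinite, ∃ α : Multiset ℂ, π.1.HasSatakeParamAt w α ∧ τ.IsUnramifiedAt w ∧ τ.HasFrobCharpolyAt w (Literature.NumberTheory.Automorphic.satakePolynomial α)) ∧ (∀ w : IsDedekindDomain.HeightOneSpectrum (NumberField.RingOfIntegers M), w ∉ 𝒰.bad → ∃ α : Multiset ℂ, π.1.HasSatakeParamAt w α ∧ τ.IsUnramifiedAt w ∧ τ.HasFrobCharpolyAt w (Literature.NumberTheory.Automorphic.satakePolynomial α))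

/-- **G∞ `UntwistAutomorphyAt`** — pointwise form of `EvenIcosahedralCMCorner.UntwistAutomorphy`
(`stmt-Langlands-14079`, closed by `EvenIcosahedralCMCornerUntwistAutomorphy.untwistAutomorphy_proof`);
leaf ATTACKABLE / PROVABLE-NOW.  If `τ = χ ⊗ σ'` entrywise, `χ` is unramified on a set `T` of places and
`τ` matches a cuspidal `π` a.e. AND at every `w ∈ T`, then `σ'` matches `π ⊗ (ω_χ⁻¹ ∘ det)` a.e. AND at
every `w ∈ T`.  Why it might fail: it does not (Arthur–Clozel Ch. 3, proof of Thm. 3.1, `ζ_v = η(ϖ_v)`,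
at a level of `ω_χ` prime to `w`).  [ArthurClozelAMS120 Ch. 3 Thm 3.1; CasselsFrohlichANT1967 VII §5.1] -/
def UntwistAutomorphyAt : Prop :=
  ∀ (M : Type) [Field M] [NumberField M] (σ' τ : Literature.NumberTheory.GaloisRepresentations.FramedGaloisRep M ℂ 2) (χ : Literature.NumberTheory.GaloisRepresentations.FramedGaloisRep M ℂ 1) (T : Set (IsDedekindDomain.HeightOneSpectrum (NumberField.RingOfIntegers M))), (∀ g : Field.absoluteGaloisGroup M, ((τ g : Matrix.GeneralLinearGroup (Fin 2) ℂ) : Matrix (Fin 2) (Fin 2) ℂ) = ((Matrix.GeneralLinearGroup.det (χ g) : ℂˣ) : ℂ) • ((σ' g : Matrix.GeneralLinearGroup (Fin 2) ℂ) : Matrix (Fin 2) (Fin 2) ℂ)) → (∀ w ∈ T, χ.IsUnramifiedAt w) → (∃ (hM : Literature.NumberTheory.Automorphic.isCompact_glFiniteIntegralLevel 2 M) (π : Literature.NumberTheory.Automorphic.CuspidalAutomorphicRepData 2 M hM), (∀ᶠ w : IsDedekindDomain.HeightOneSpectrum (NumberField.RingOfIntegers M) in Filter.cofinite, ∃ α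 : Multiset ℂ, π.1.HasSatakeParamAt w α ∧ τ.IsUnramifiedAt w ∧ τ.HasFrobCharpolyAt w (Literature.NumberTheory.Automorphic.satakePolynomial α)) ∧ (∀ w ∈ T, ∃ α : Multiset ℂ, π.1.HasSatakeParamAt w α ∧ τ.IsUnramifiedAt w ∧ τ.HasFrobCharpolyAt w (Literature.NumberTheory.Automorphic.satakePolynomial α))) → ∃ (hM : Literature.NumberTheory.Automorphic.isCompact_glFiniteIntegralLevel 2 M) (π : Literature.NumberTheory.Automorphic.CuspidalAutomorphicRepData 2 M hM), (∀ᶠ w : IsDedekindDomain.HeightOneSpectrum (NumberField.RingOfIntegers M) in Filter.cofinite, ∃ α : Multiset ℂ, π.1.HasSatakeParamAt w α ∧ σ'.IsUnramifiedAt w ∧ σ'.HasFrobCharpolyAt w (Literature.NumberTheory.Automorphic.satakePolynomial α)) ∧ (∀ w ∈ T, ∃ α : Multiset ℂ, π.1.HasSatakeParamAt w α ∧ σ'.IsUnramifiedAt w ∧ σ'.HasFrobCharpolyAt w (Literature.NumberTheory.Automorphic.satakePolynomial α))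

/-- **H∞ `CofinalCyclicDescent`** — WEAKER than `EvenIcosahedralCMCorner.SolubleDescentMatching`
(`stmt-Langlands-14077`) and implied by strong Artin for `σ`; leaf ATTACKABLE (a theorem of cyclic base
change).  Let `σ : Γ_ℚ → GL₂(ℂ)` be irreducible with projective image `A₅`.  Suppose that for all but
finitely many rational primes `p` there are number fields `M ⊆ M'` with `M'` CM, `M'/ℚ` Galois, `Gal(M'/ℚ)` CYCLIC,
`[M':ℚ]` SQUAREFREE with odd prime divisors in `[2^p, 2^{p+1})`, `p` SPLIT COMPLETELY in `M'`, and a cuspidal `π'` on `GL₂(𝔸_{M'})` whose Satake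
parameters give `charpoly σ|_{M'}(Frob_w)` at all but finitely many `w` AND at every `w ∣ p`.  Then
there is a cuspidal `π` on `GL₂(𝔸_ℚ)` matching `σ` at all but finitely many `p`.  Proof route: module
docstring, rung `ω` (1)–(3).  Why it might fail: step (2) needs "two finite-order twists of cuspidal
`π` on `GL₂/ℚ` with equal Satake data at a.e. prime are equal" (JS) and non-dihedrality of every
descent (no quadratic self-twist) — a dihedral descent would break the torsor count.
[ArthurClozelAMS120 Ch. 3 Thm 3.1, Lemma 6.3, Lemma 6.6; Langlands1980 §2; JacquetShalika1981 Thm 4.4;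
LapidRogawski1998] -/
def CofinalCyclicDescent : Prop :=
  ∀ σ : Literature.NumberTheory.GaloisRepresentations.FramedGaloisRep ℚ ℂ 2, σ.toGaloisRep.IsIrreducible → Nonempty ((Matrix.ProjGenLinGroup.mk.comp σ.toMonoidHom).range ≃* alternatingGroup (Fin 5)) → (∀ᶠ p : IsDedekindDomain.HeightOneSpectrum (NumberField.RingOfIntegers ℚ) in Filter.cofinite, ∃ (M : Type) (_ : Field M) (_ : NumberField M) (M' : Type) (_ : Field M') (_ : NumberField M') (_ : Algebra M M'), NumberField.IsCMField M' ∧ IsGalois ℚ M' ∧ IsCyclic (M' ≃ₐ[ℚ] M') ∧ Squarefree (Module.finrank ℚ M') ∧ (∀ ℓ : ℕ, ℓ.Prime → ℓ ∣ Module.finrank ℚ M' → ℓ = 2 ∨ (2 ^ Ideal.absNorm p.asIdeal ≤ ℓ ∧ ℓ < 2 ^ (Ideal.absNorm p.asIdeal + 1))) ∧ (∀ w : IsDedekindDomain.HeightOneSpectrum (NumberField.RingOfIntegers M'), w.asIdeal.under (NumberField.RingOfIntegers ℚ) = p.asIdeal → w.asIdeal.inertiaDeg (NumberField.RingOfIntegers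 ℚ) = 1 ∧ w.asIdeal.ramificationIdx (NumberField.RingOfIntegers ℚ) = 1) ∧ ∃ (hM' : Literature.NumberTheory.Automorphic.isCompact_glFiniteIntegralLevel 2 M') (π' : Literature.NumberTheory.Automorphic.CuspidalAutomorphicRepData 2 M' hM'), (∀ᶠ w : IsDedekindDomain.HeightOneSpectrum (NumberField.RingOfIntegers M') in Filter.cofinite, ∃ α : Multiset ℂ, π'.1.HasSatakeParamAt w α ∧ (Literature.NumberTheory.GaloisRepresentations.FramedGaloisRep.restrictField M' (Literature.NumberTheory.GaloisRepresentations.FramedGaloisRep.restrictField M σ)).IsUnramifiedAt w ∧ (Literature.NumberTheory.GaloisRepresentations.FramedGaloisRep.restrictField M' (Literature.NumberTheory.GaloisRepresentations.FramedGaloisRep.restrictField M σ)).HasFrobCharpolyAt w (Literature.NumberTheory.Automorphic.satakePolynomial α)) ∧ (∀ w : IsDedekindDomain.HeightOneSpectrum (NumberField.RingOfIntegers M'), w.asIdeal.under (NumberField.RingOfIntegers ℚ) = p.asIdeal → ∃ α : Multiset ℂ, π'.1.HasSatakeParamAt w α ∧ (Literature.NumberTheory.GaloisRepresentations.FramedGaloisRep.restrictField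 M' (Literature.NumberTheory.GaloisRepresentations.FramedGaloisRep.restrictField M σ)).IsUnramifiedAt w ∧ (Literature.NumberTheory.GaloisRepresentations.FramedGaloisRep.restrictField M' (Literature.NumberTheory.GaloisRepresentations.FramedGaloisRep.restrictField M σ)).HasFrobCharpolyAt w (Literature.NumberTheory.Automorphic.satakePolynomial α))) → ∃ (hcpt : Literature.NumberTheory.Automorphic.isCompact_glFiniteIntegralLevel 2 ℚ) (π : Literature.NumberTheory.Automorphic.CuspidalAutomorphicRepData 2 ℚ hcpt), ∀ᶠ v : IsDedekindDomain.HeightOneSpectrum (NumberField.RingOfIntegers ℚ) in Filter.cofinite, ∃ α : Multiset ℂ, π.1.HasSatakeParamAt v α ∧ σ.IsUnramifiedAt v ∧ σ.HasFrobCharpolyAt v (Literature.NumberTheory.Automorphic.satakePolynomial α)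

open scoped MatrixGroups
open NumberField IsDedekindDomain Filter
open Literature.NumberTheory.GaloisRepresentations Literature.NumberTheory.Automorphic

/-! ### Certificates of the ladder order (kernel-checked comparisons with the route's items) -/

/-- A cyclic Galois group is solvable. [folklore] -/
theorem isSolvable_of_isCyclic' {G : Type*} [Group G] [IsCyclic G] : IsSolvable G :=
  isSolvable_of_comm fun a b => (IsCyclic.commGroup (α := G)).mul_comm a b

/-- **Rung `ω` lies BELOW rung `1`**: the route's `SolubleDescentMatching` implies `CofinalCyclicDescent`
(one member of the cofinal family is a soluble field with an a.e. matching, which is all rung `1` uses).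
This is the kernel certificate that the new crux is WEAKER than the one it replaces. [folklore] -/
theorem cofinalCyclicDescent_of_solubleDescentMatching (hH : SolubleDescentMatching) :
    CofinalCyclicDescent := by
  intro σ hirr hico hev
  haveI := infinite_heightOneSpectrum' ℚ
  obtain ⟨p, M, _, _, M', _, _, _, -, hGal, hCyc, -, -, -, hM', π', hae, -⟩ := hev.exists
  haveI := hCyc
  exact hH σ hirr hico M M' hGal isSolvable_of_isCyclic' ⟨hM', π', hae⟩

/-- **D∞ is STRONGER than the route's door**: `CofinalSplitDoor → CMOrdinaryDoor`. [folklore] -/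
theorem cmOrdinaryDoor_of_cofinalSplitDoor (hD : CofinalSplitDoor) : CMOrdinaryDoor := by
  intro ι σ hirr hico heven h3
  haveI := infinite_heightOneSpectrum' ℚ
  obtain ⟨p, M, _, _, hCM, hGal, hCyc, -, -, -, -, hζ, χ, τ, τ₃, htw, hav, hfin, -, hhyp⟩ :=
    (hD ι σ hirr hico heven h3).exists
  haveI := hCyc
  exact ⟨M, inferInstance, inferInstance, hCM, hGal, isSolvable_of_isCyclic', hζ, χ, τ, τ₃, htw, hav, hfin, hhyp⟩

/-- **F∞ is STRONGER than the route's wall**: `ClassicalityOffBadPlaces → ArtinPointClassicalityCM`.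
[folklore] -/
theorem artinPointClassicalityCM_of_classicalityOffBadPlaces (hF : ClassicalityOffBadPlaces) :
    ArtinPointClassicalityCM := by
  intro ι M _ _ hCM τ τ₃ hav hfin hico h𝒰
  obtain ⟨𝒰, hpa⟩ := h𝒰
  obtain ⟨hM, π, hae, -⟩ := hF ι M hCM τ τ₃ hav hfin hico 𝒰 hpa
  exact ⟨hM, π, hae⟩

/-- **G∞ is STRONGER than the route's (closed) untwisting item**: `UntwistAutomorphyAt → UntwistAutomorphy`
(take `T = ∅`). [folklore] -/
theorem untwistAutomorphy_of_untwistAutomorphyAt (hG : UntwistAutomorphyAt) : UntwistAutomorphy := by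
  intro M _ _ σ' τ χ htw haut
  obtain ⟨hM, π, hae⟩ := haut
  obtain ⟨hM', π', hae', -⟩ := hG M σ' τ χ ∅ htw (fun w hw => absurd hw (Set.notMem_empty w))
    ⟨hM, π, hae, fun w hw => absurd hw (Set.notMem_empty w)⟩
  exact ⟨hM', π', hae'⟩

/-! ### A decided leaf: `UntwistAutomorphyAt` (G∞) is a THEOREM -/

section Untwist

open scoped Polynomial
open Polynomial Summit.Langlands.Langlands.Theorems.EvenIcosahedralCMCornerUntwistAutomorphy

/-- Elements of `GL_m(𝒪)` (entries of `g` and `g⁻¹` integral) have unit determinant (Leibniz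
expansion; same statement as `Ash2003.valued_det_eq_one`, re-proved to keep the node's imports light).
[folklore] -/
theorem valued_det_eq_one' {K Γ₀ : Type*} [Field K] [LinearOrderedCommGroupWithZero Γ₀] [Valued K Γ₀]
    {m : Type*} [Fintype m] [DecidableEq m] {g : GL m K}
    (h₁ : ∀ i j, Valued.v ((g : Matrix m m K) i j) ≤ 1)
    (h₂ : ∀ i j, Valued.v (((g⁻¹ : GL m K) : Matrix m m K) i j) ≤ 1) :
    Valued.v ((Matrix.GeneralLinearGroup.det g : Kˣ) : K) = 1 := by
  have hle_of : ∀ {M : Matrix m m K}, (∀ i j, Valued.v (M i j) ≤ 1) → Valued.v M.det ≤ 1 := by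
    intro M hM
    rw [Matrix.det_apply]
    refine Valued.v.map_sum_le fun σ _ => ?_
    rw [Units.smul_def, zsmul_eq_mul, map_mul]
    refine mul_le_one' ?_ ?_
    · rcases Int.units_eq_one_or (Equiv.Perm.sign σ) with h | h <;> simp [h]
    · rw [map_prod]
      exact Finset.prod_le_one' fun i _ => hM _ _
  have hle : Valued.v ((Matrix.GeneralLinearGroup.det g : Kˣ) : K) ≤ 1 := hle_of h₁
  have hle' : Valued.v ((Matrix.GeneralLinearGroup.det g⁻¹ : Kˣ) : K) ≤ 1 := hle_of h₂
  have hmul : Valued.v ((Matrix.GeneralLinearGroup.det g : Kˣ) : K) *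
      Valued.v ((Matrix.GeneralLinearGroup.det g⁻¹ : Kˣ) : K) = 1 := by
    rw [← map_mul, ← Units.val_mul, ← map_mul, mul_inv_cancel, map_one, Units.val_one, map_one]
  refine le_antisymm hle ?_
  calc (1 : Γ₀) = Valued.v ((Matrix.GeneralLinearGroup.det g : Kˣ) : K) *
        Valued.v ((Matrix.GeneralLinearGroup.det g⁻¹ : Kˣ) : K) := hmul.symm
    _ ≤ Valued.v ((Matrix.GeneralLinearGroup.det g : Kˣ) : K) * 1 := by gcongr
    _ = _ := mul_one _

/-- **A level of `χ ∘ det` prime to an unramified place.**  If the Hecke character `χ` has finite order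
and is unramified at `w`, then `χ ∘ det` is trivial on some principal congruence subgroup `K(𝔪)` with
`w ∤ 𝔪`: take any level `𝔪₀` (`HeckeCharacter.exists_level_of_isFiniteOrder`), strip the `w`-part
(`exists_level_not_dvd`: `K(𝔪) ∋ g = g₀ · ι_w(t)`, `g₀ ∈ K(𝔪₀)`, `t ∈ GL_n(𝒪_w)`), and use
`det ι_w(t) = ⟨det t⟩_w` (`GLn.det_ofLocal`) with `|det t|_w = 1`, killed by the unramified `χ`.
Tate, in Cassels–Fröhlich Ch. VII §4; Bump, *Automorphic forms and representations*, §3.3. [folklore] -/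
theorem exists_level_not_dvd_of_isUnramifiedAt (n : ℕ) {K : Type} [Field K] [NumberField K]
    {χ : HeckeCharacter K} (hχ : χ.IsFiniteOrder) {w : HeightOneSpectrum (𝓞 K)}
    (hw : χ.IsUnramifiedAt w) :
    ∃ 𝔪 : Ideal (𝓞 K), 𝔪 ≠ 0 ∧ ¬ w.asIdeal ∣ 𝔪 ∧
      ∀ k ∈ principalCongruenceLevel n K 𝔪, χ (Matrix.GeneralLinearGroup.det k) = 1 := by
  obtain ⟨𝔪₀, h𝔪₀, h0⟩ := HeckeCharacter.exists_level_of_isFiniteOrder n hχ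
  obtain ⟨𝔪, h𝔪, hndvd, -, hsplit⟩ := exists_level_not_dvd n h𝔪₀ w
  refine ⟨𝔪, h𝔪, hndvd, fun k hk => ?_⟩
  obtain ⟨t, ht, hk₀⟩ := hsplit k hk
  rw [mem_valuedCongruenceSubgroup_iff] at ht
  have h1 : χ (Matrix.GeneralLinearGroup.det (k * (GLn.ofLocal n K w t)⁻¹)) = 1 := h0 _ hk₀
  have h2 : χ (Matrix.GeneralLinearGroup.det (GLn.ofLocal n K w t)) = 1 := by
    rw [GLn.det_ofLocal]
    exact hw.map_localUnits_eq_one _ (valued_det_eq_one' ht.1 ht.2.1)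
  calc χ (Matrix.GeneralLinearGroup.det k)
      = χ (Matrix.GeneralLinearGroup.det (k * (GLn.ofLocal n K w t)⁻¹ * GLn.ofLocal n K w t)) := by
        rw [inv_mul_cancel_right]
    _ = 1 := by rw [map_mul, map_mul, h1, h2, one_mul]

/-- **`UntwistAutomorphyAt` holds** (G∞ is a theorem): twist `π` by the inverse of the finite-order Hecke
character `ω` of `χ` (Artin reciprocity, `artinReciprocity_character_holds`); almost everywhere this is the
g32 proof of item `14079`, and AT a place `w ∈ T` — where `χ`, hence `ω`, is unramified — the Satake
parameter of `π ⊗ (ω⁻¹ ∘ det)` is `ω(ϖ_w)⁻¹ · α_w` by `HasSatakeParamAt.twist_of_isUnramifiedAt` at a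
level prime to `w` (`exists_level_not_dvd_of_isUnramifiedAt`).  Arthur–Clozel 1989, Ch. 3, proof of
Thm. 3.1 (`ζ_v = η(ϖ_v)`). [cite: ArthurClozelAMS120, Ch. 3, Thm. 3.1 (p. 172)] -/
theorem untwistAutomorphyAt_proof : UntwistAutomorphyAt := by
  intro M _ _ σ' τ χ T hτ hχT haut
  obtain ⟨hM, π, hae, hpt⟩ := haut
  classical
  obtain ⟨ω, hfin, hω⟩ := artinReciprocity_character_holds M χ
  have hfin' : (ω⁻¹).IsFiniteOrder := IsOfFinOrder.inv hfin
  refine ⟨hM, π.twist ω⁻¹ hfin', ?_, fun w hw => ?_⟩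
  · have h2 := AutomorphicRepData.eventually_hasSatakeParamAt_twist π.1 hfin'
    have h3 : ∀ᶠ w : HeightOneSpectrum (𝓞 M) in cofinite, χ.IsUnramifiedAt w :=
      FramedArtinRep.eventually_isUnramifiedAt χ
    filter_upwards [hae, h2, h3] with w hw htw hχw
    obtain ⟨α, hαπ, hτw, hτF⟩ := hw
    refine ⟨α.map ((ω.valueAtUniformizer w)⁻¹ * ·), ?_, isUnramifiedAt_of_entry_twist σ' τ χ hτ hτw hχw,
      fun 𝔓 h𝔓 Φ hΦ => ?_⟩
    · have h := htw α hαπ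
      rw [HeckeCharacter.valueAtUniformizer_inv] at h
      rw [CuspidalAutomorphicRepData.twist_val]
      exact h
    · exact charpoly_of_entry_twist σ' τ χ hτ Φ
        (det_eq_of_hasFrobCharpolyAt_rank_one χ (hω w hχw).2 h𝔓 hΦ) (hτF 𝔓 h𝔓 Φ hΦ)
  · obtain ⟨α, hαπ, hτw, hτF⟩ := hpt w hw
    have hχw := hχT w hw
    have hωw : (ω⁻¹).IsUnramifiedAt w := HeckeCharacter.isUnramifiedAt_inv_iff.mpr (hω w hχw).1
    obtain ⟨𝔪, h𝔪, hndvd, hχ𝔪⟩ := exists_level_not_dvd_of_isUnramifiedAt 2 hfin' hωw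
    refine ⟨α.map ((ω.valueAtUniformizer w)⁻¹ * ·), ?_, isUnramifiedAt_of_entry_twist σ' τ χ hτ hτw hχw,
      fun 𝔓 h𝔓 Φ hΦ => ?_⟩
    · have h := hαπ.twist_of_isUnramifiedAt hfin' h𝔪 hχ𝔪 hndvd hωw
      rw [HeckeCharacter.valueAtUniformizer_inv] at h
      rw [CuspidalAutomorphicRepData.twist_val]
      exact h
    · exact charpoly_of_entry_twist σ' τ χ hτ Φ
        (det_eq_of_hasFrobCharpolyAt_rank_one χ (hω w hχw).2 h𝔓 hΦ) (hτF 𝔓 h𝔓 Φ hΦ)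

end Untwist

/-! ### The deciding theorem of the node -/

/-- **`langlands_of_pieces`** — the node's deciding theorem: the five pieces, the route's residual complement
and its junction imply `Langlands`.  Same architecture as `EvenIcosahedralCMCorner.closes`; in the
`3`-distinguished branch the descent hypothesis `CofinalCyclicDescent` is fed, prime by prime along the
cofinite filter delivered by the door, by engine → wall → pointwise untwist, the matching ABOVE `p` being
carried by the tame level (`w ∉ 𝒰.bad`) and the unramifiedness of `χ` above `p`. -/
theorem langlands_of_pieces (hD : CofinalSplitDoor) (hE : ShapePreservingEngine) (hF : ClassicalityOffBadPlaces)
    (hG : UntwistAutomorphyAt) (hH : CofinalCyclicDescent) (hC : NonDistinguishedComplement)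
    (hJ : SectorJunction) : _root_.Langlands := by
  obtain ⟨ι⟩ := PadicAlgCl.nonempty_ringEquiv_complex 3
  refine hJ fun σ hirr hico heven ↦ ?_
  by_cases h3 : ∀ v : IsDedekindDomain.HeightOneSpectrum (NumberField.RingOfIntegers ℚ), (3 : NumberField.RingOfIntegers ℚ) ∈ v.asIdeal → σ.IsUnramifiedAt v ∧ ∃ t d : ℂ, σ.HasFrobCharpolyAt v (Polynomial.X ^ 2 - Polynomial.C t * Polynomial.X + Polynomial.C d) ∧ t ^ 2 ≠ d ∧ t ^ 2 ≠ 4 * d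
  · -- the 3-distinguished sub-sector: cofinal door → engine → wall → pointwise untwist, prime by prime
    refine hH σ hirr hico ?_
    filter_upwards [hD ι σ hirr hico heven h3] with p hp
    obtain ⟨M, _, _, hCM, hGal, hCyc, hSq, hWin, hSplit, hK3, hζ, χ, τ, τ₃, htw, hav, hfin, hunr, hhyp⟩ := hp
    obtain ⟨M', _, _, _, hCM', hGal', hCyc', hSq', hWin', hSplit', hfin', hico', 𝒰, hbad, hpa⟩ :=
      hE ι M p hCM hGal hCyc hSq hWin hSplit hK3 hζ τ₃ hfin (fun w hw ↦ (hunr w hw).2) hhyp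
    obtain ⟨hM'c, π', hae, hpt⟩ := hF ι M' hCM' (τ.restrictField M') (τ₃.restrictField M')
      (fun g ↦ hav _) hfin' hico' 𝒰 hpa
    -- `χ|_{M'}` is unramified above `p`
    have hT : ∀ w' ∈ {w' : HeightOneSpectrum (𝓞 M') | w'.asIdeal.under (𝓞 ℚ) = p.asIdeal},
        (χ.restrictField M').IsUnramifiedAt w' := by
      intro w' hw'
      obtain ⟨w, hw⟩ := exists_under_eq (F := M) w'
      have hwp : w.asIdeal.under (𝓞 ℚ) = p.asIdeal := by
        rw [← hw, Ideal.under_under]; exact hw'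
      exact χ.isUnramifiedAt_restrictField hw (hunr w hwp).1
    obtain ⟨hM'', π'', hae', hpt'⟩ := hG M' ((σ.restrictField M).restrictField M') (τ.restrictField M')
      (χ.restrictField M') {w' | w'.asIdeal.under (𝓞 ℚ) = p.asIdeal} (fun g ↦ htw _) hT
      ⟨hM'c, π', hae, fun w' hw' ↦ hpt w' (hbad w' hw')⟩
    exact ⟨M, inferInstance, inferInstance, M', inferInstance, inferInstance, inferInstance, hCM', hGal', hCyc', hSq',
      hWin', hSplit', hM'', π'', hae', fun w' hw' ↦ hpt' w' hw'⟩
  · exact hC σ hirr hico heven h3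

/-- **`closes_target`** — the deciding theorem with the decided leaf G∞ discharged in kernel:
FOUR open pieces (D∞, E∞, F∞, H∞) plus the route's residual and junction imply `Langlands`. -/
theorem closes_target (hD : CofinalSplitDoor) (hE : ShapePreservingEngine) (hF : ClassicalityOffBadPlaces)
    (hH : CofinalCyclicDescent) (hC : NonDistinguishedComplement) (hJ : SectorJunction) : _root_.Langlands :=
  langlands_of_pieces hD hE hF untwistAutomorphyAt_proof hH hC hJ

end Summit.Langlands.Langlands.Theorems.SplitPrimeDescentLadder

end
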